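import Literature.Barriers.ValiantsHypothesis.BIJL18PermanentZeroProofs
import HarnessLib

/-!
# Empty gates have formal degree `0`: the tree's `VP⁰` contains `X₀ + 2^{2^n}`

Bürgisser, *On defining integers and proving arithmetic circuit lower bounds* (ECCC TR06-113 =
Comput. Complexity 18 (2009)), §2.2 and Def. 2.7: in the constant-free model every computation
gate has EXACTLY two operands, inputs and constants have formal degree `1`, and `VP⁰` asks for
polynomially bounded size AND formal degree; the formal degree is what keeps cheaply computable
but huge integers such as `2^{2^n}` (`n` squarings) out of `VP⁰`. The tree's rendering
(`ConstantFreeValiant.lean`: `ArithCircuit.formalDegree`, `IsVP0Family`) works in Bürgisser 2000's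
list model `ArithCircuit` with `IsFanInTwo` = fan-in AT MOST two, and gives the EMPTY gates
`Σ ∅ = 0`, `Π ∅ = 1` formal degree `0`; its module docstring calls these "edge cases outside
Bürgisser's fan-in-exactly-two model, immaterial for the classes (polynomial bounds)".

## What is here (all proved; no named facts)

That remark is false, and this file records exactly how (an erratum on the TREE's model, not on
any printed statement):

* `VP0EmptyGates.powGates`, `VP0EmptyGates.circuit`, `VP0EmptyGates.family` — the gates
  `g₀ = Π ∅`, `g₁ = g₀ + g₀`, `g_{i+1} = g_i ⊗ g_i` all have formal degree `0`
  (`gateFormalDegrees_powGates`) and values `1, 2, 4, …, 2^{2^m}` (`eval_gate_powGates`), so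
  `X₀ + 2^{2^m}` has a fan-in-`≤ 2`, sign-constant circuit of size `m + 3` and FORMAL DEGREE `1`
  (`eval_circuit`, `formalDegree_circuit`), whence `(X₀ + 2^{2^n})_n` is `IsVP0Family`
  (`isVP0Family_family`);
* `VP0EmptyGates.not_exists_exactFanInTwo_family` — no family of fan-in-EXACTLY-two sign-constant
  circuits of p-bounded size `s_n` and formal degree `d_n` computes it: BIJL Lemma 25
  ([FPdV13]; the tree's `BIJL2018_lemma25_holds`) bounds the height `Σ |coeff|` by `2^{s_n d_n}`,
  and `2^{2^n} > 2^{s_n d_n}` eventually (`IsPBounded.exists_lt_two_pow_self`);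
* `exists_isVP0Family_not_exactFanInTwo` — the packaged separation;
* the converse bookkeeping `ArithCircuit.exists_exactFanInTwo_of_forall_one_le_fanIn`: a
  fan-in-`≤ 2` circuit WITHOUT empty gates is padded (`Gate.pad`: `a • u ↦ a • u + 0 • u`,
  `Π [u] ↦ 1 • u + 0 • u`) to a fan-in-exactly-two circuit with the same value, size and formal
  degree, sign constants preserved — so the empty gates are the whole difference.

Consequences for typed statements (recorded, nothing re-typed here): a statement with
`IsVP0Family` / `IsVNP0Family` in a HYPOTHESIS (e.g. `HasVP0NaturalProofsAgainstPerZero` in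
`BIJL2018_thm6`, the `VNP⁰` hypotheses of Bürgisser 2009 Thms. 2.10/2.11) quantifies over a
larger class than the print, hence is stronger than the printed statement; in a conclusion it is
weaker; and the height bound of Lemma 25 (typed, correctly, for fan-in exactly two) is NOT
available for `IsVP0Family` circuits — a `VP⁰` natural proof `D_n` in the tree's sense may carry
coefficients `2^{2^n}` (multiply by `X₁₁ + 2^{2^n}`).

## References

* [Burgisser2006] P. Bürgisser, *On defining integers and proving arithmetic circuit lower
  bounds*, ECCC TR06-113 (2006) = Comput. Complexity 18 (2009) 81–103, §2.2, Def. 2.7.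
* [BlaserIkenmeyerJindalLysikov2018] M. Bläser, C. Ikenmeyer, G. Jindal, V. Lysikov,
  *Generalized matrix completion and algebraic natural proofs*, STOC 2018 / ECCC TR18-064,
  Lemma 25 (after Fournier–Perifel–de Verclos 2013), ECCC p. 18.
* [Burgisser2000] P. Bürgisser, *Completeness and Reduction in Algebraic Complexity Theory*,
  Springer 2000, Def. 2.1 (the list model `ArithCircuit`).
-/

noncomputable section

namespace Literature.Computability.AlgebraicComplexity

open MvPolynomial ArithCircuit Literature.Barriers.ValiantsHypothesis

/-! ### Padding fan-in-one gates: without empty gates the two models agree -/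

namespace ArithCircuit

variable {k : Type*} [CommSemiring k] {σ : Type*}

/-- Pad a gate of fan-in one to fan-in two without changing value or formal degree:
`a • u ↦ a • u + 0 • u`, `Π [u] ↦ 1 • u + 0 • u`; all other gates unchanged.
[cite: Burgisser2006, §2.2] -/
def Gate.pad : Gate k σ → Gate k σ
  | .sum [a] => .sum [a, (0, a.2)]
  | .prod [u] => .sum [(1, u), (0, u)]
  | g => g

/-- Padding does not change the value. [cite: Burgisser2000, Def. 2.1] -/
theorem Gate.eval_pad (vals : List (MvPolynomial σ k)) (g : Gate k σ) :
    g.pad.eval vals = g.eval vals := by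
  rcases g with args | args
  · rcases args with _ | ⟨a, _ | ⟨b, l⟩⟩ <;> simp [Gate.pad, Gate.eval]
  · rcases args with _ | ⟨u, _ | ⟨w, l⟩⟩ <;> simp [Gate.pad, Gate.eval]

/-- Padding does not change the formal degree. [cite: Burgisser2006, §2.2] -/
theorem Gate.formalDegree_pad (degs : List ℕ) (g : Gate k σ) :
    g.pad.formalDegree degs = g.formalDegree degs := by
  rcases g with args | args
  · rcases args with _ | ⟨a, _ | ⟨b, l⟩⟩ <;> simp [Gate.pad, Gate.formalDegree]
  · rcases args with _ | ⟨u, _ | ⟨w, l⟩⟩ <;> simp [Gate.pad, Gate.formalDegree]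

/-- A padded gate of fan-in `1` or `2` has fan-in exactly `2`. [cite: Burgisser2006, §2.2] -/
theorem Gate.fanIn_pad {g : Gate k σ} (h1 : 1 ≤ g.fanIn) (h2 : g.fanIn ≤ 2) :
    g.pad.fanIn = 2 := by
  rcases g with args | args
  · rcases args with _ | ⟨a, _ | ⟨b, _ | ⟨c, l⟩⟩⟩ <;> simp_all [Gate.pad, Gate.fanIn, Gate.args]
  · rcases args with _ | ⟨u, _ | ⟨w, _ | ⟨c, l⟩⟩⟩ <;> simp_all [Gate.pad, Gate.fanIn, Gate.args]

/-- Padding preserves sign constants (the new coefficients are `0` and `1`).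
[cite: Burgisser2000, §1.4] -/
theorem Gate.hasSignConstants_pad {g : Gate k σ}
    (hg : g.HasSignConstants) : g.pad.HasSignConstants := by
  rcases g with args | args
  · rcases args with _ | ⟨a, _ | ⟨b, l⟩⟩
    · exact hg
    · simp only [Gate.pad, Gate.HasSignConstants, List.mem_cons, List.mem_nil_iff, or_false,
        forall_eq_or_imp, forall_eq]
      simp only [Gate.HasSignConstants, List.mem_singleton, forall_eq] at hg
      exact ⟨hg, Or.inl rfl, hg.2⟩
    · exact hg
  · rcases args with _ | ⟨u, _ | ⟨w, l⟩⟩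
    · exact hg
    · simp only [Gate.pad, Gate.HasSignConstants, List.mem_cons, List.mem_nil_iff, or_false,
        forall_eq_or_imp, forall_eq]
      simp only [Gate.HasSignConstants, List.mem_singleton, forall_eq] at hg
      exact ⟨⟨Or.inr (Or.inl rfl), hg⟩, Or.inl rfl, hg⟩
    · exact hg

/-- Padding every gate does not change the value list. [cite: Burgisser2000, Def. 2.1] -/
theorem gateValues_map_pad (gs : List (Gate k σ)) :
    gateValues (gs.map Gate.pad) = gateValues gs := by
  induction gs using List.reverseRecOn with
  | nil => rfl
  | append_singleton gs g ih =>
    rw [List.map_append, List.map_singleton, gateValues_append_singleton,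
      gateValues_append_singleton, ih, Gate.eval_pad]

/-- Padding every gate does not change the formal-degree list. [cite: Burgisser2006, §2.2] -/
theorem gateFormalDegrees_map_pad (gs : List (Gate k σ)) :
    gateFormalDegrees (gs.map Gate.pad) = gateFormalDegrees gs := by
  induction gs using List.reverseRecOn with
  | nil => rfl
  | append_singleton gs g ih =>
    rw [List.map_append, List.map_singleton, gateFormalDegrees_append_singleton,
      gateFormalDegrees_append_singleton, ih, Gate.formalDegree_pad]

/-- **Without empty gates, fan-in `≤ 2` is as good as fan-in exactly `2`.** If every gate of a
fan-in-two circuit has at least one operand, padding the fan-in-one gates yields a circuit in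
which every gate has exactly two operands, with the same value, size and formal degree, and
with sign constants if the original had them — so the empty gates `Σ ∅`, `Π ∅` are the ONLY
source of the discrepancy exhibited below. [cite: Burgisser2006, §2.2 and Def. 2.7] -/
theorem exists_exactFanInTwo_of_forall_one_le_fanIn (P : ArithCircuit k σ) (h2 : P.IsFanInTwo)
    (h1 : ∀ g ∈ P.gates, 1 ≤ g.fanIn) :
    ∃ Q : ArithCircuit k σ, (∀ g ∈ Q.gates, g.fanIn = 2) ∧ Q.eval = P.eval ∧ Q.size = P.size ∧
      Q.formalDegree = P.formalDegree ∧ (P.HasSignConstants → Q.HasSignConstants) := by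
  refine ⟨⟨P.gates.map Gate.pad, P.output⟩, fun g hg => ?_, ?_, by simp [ArithCircuit.size], ?_,
    fun hsc => ⟨fun g hg => ?_, hsc.2⟩⟩
  · obtain ⟨g', hg', rfl⟩ := List.mem_map.1 hg
    exact Gate.fanIn_pad (h1 g' hg') (h2 g' hg')
  · simp only [ArithCircuit.eval, gateValues_map_pad]
  · simp only [ArithCircuit.formalDegree, gateFormalDegrees_map_pad]
  · obtain ⟨g', hg', rfl⟩ := List.mem_map.1 hg
    exact Gate.hasSignConstants_pad (hsc.1 g' hg')

end ArithCircuit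

namespace VP0EmptyGates

/-- The gate list `g₀ = Π ∅ (= 1)`, `g₁ = 1·g₀ + 1·g₀ (= 2)`, `g_{i+1} = g_i ⊗ g_i` (`2 ≤ i + 1 ≤ m + 1`):
`m + 2` fan-in-`≤ 2` sign-constant gates, all of FORMAL DEGREE `0`, the last of value `2^{2^m}`.
[cite: Burgisser2006, §2.2] -/
def powGates : ℕ → List (Gate ℤ (Fin 1))
  | 0 => [Gate.prod [], Gate.sum [(1, .gate 0), (1, .gate 0)]]
  | m + 1 => powGates m ++ [Gate.prod [.gate (m + 1), .gate (m + 1)]]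

/-- The circuit `X₀ + g_{m+1}`: size `m + 3`, formal degree `1`, value `X₀ + 2^{2^m}`.
[cite: Burgisser2006, §2.2] -/
def circuit (m : ℕ) : ArithCircuit ℤ (Fin 1) :=
  ⟨powGates m ++ [Gate.sum [(1, .var 0), (1, .gate (m + 1))]], .gate (m + 2)⟩

/-- The family `f_n = X₀ + 2^{2^n} ∈ ℤ[X₀]`. [cite: Burgisser2006, §2.2] -/
def family (n : ℕ) : MvPolynomial (Fin 1) ℤ := X 0 + C (2 ^ 2 ^ n)

/-- `m + 2` gates. [cite: Burgisser2000, Def. 2.1] -/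
@[simp] theorem length_powGates (m : ℕ) : (powGates m).length = m + 2 := by
  induction m with
  | zero => rfl
  | succ m ih => simp [powGates, ih]

/-- Fan-in at most two (the first gate has fan-in `0`). [cite: Burgisser2000, Def. 2.1] -/
theorem fanIn_powGates (m : ℕ) : ∀ g ∈ powGates m, g.fanIn ≤ 2 := by
  induction m with
  | zero =>
    intro g hg
    simp only [powGates, List.mem_cons, List.mem_nil_iff, or_false] at hg
    rcases hg with rfl | rfl <;> simp [Gate.fanIn, Gate.args]
  | succ m ih =>
    intro g hg
    simp only [powGates, List.mem_append, List.mem_singleton] at hg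
    rcases hg with hg | rfl
    · exact ih g hg
    · simp [Gate.fanIn, Gate.args]

/-- Sign constants (all coefficients `1`, no constant operands). [cite: Burgisser2000, §1.4] -/
theorem hasSignConstants_powGates (m : ℕ) : ∀ g ∈ powGates m, g.HasSignConstants := by
  induction m with
  | zero =>
    intro g hg
    simp only [powGates, List.mem_cons, List.mem_nil_iff, or_false] at hg
    rcases hg with rfl | rfl
    · simp [Gate.HasSignConstants]
    · simp [Gate.HasSignConstants, Operand.HasSignConstants, IsSignConstant]
  | succ m ih =>
    intro g hg
    simp only [powGates, List.mem_append, List.mem_singleton] at hg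
    rcases hg with hg | rfl
    · exact ih g hg
    · simp [Gate.HasSignConstants, Operand.HasSignConstants]

/-- The value of the last gate is the constant `2^{2^m}` (`m` squarings of `1 + 1`).
[cite: Burgisser2006, §2.2] -/
theorem eval_gate_powGates (m : ℕ) :
    (Operand.gate (m + 1) : Operand ℤ (Fin 1)).eval (gateValues (powGates m)) = C (2 ^ 2 ^ m) := by
  induction m with
  | zero =>
    simp [powGates, gateValues, Gate.eval, Operand.eval]
    norm_num
  | succ m ih =>
    have hl : (gateValues (powGates m)).length = m + 2 := by simp
    rw [powGates, gateValues_append_singleton]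
    simp only [Operand.eval, List.getD_eq_getElem?_getD] at ih ⊢
    rw [List.getElem?_append_right (by omega), hl, Nat.sub_self, List.getElem?_cons_zero,
      Option.getD_some]
    simp only [Gate.eval, List.map_cons, List.map_nil, List.prod_cons, List.prod_nil, mul_one,
      Operand.eval, List.getD_eq_getElem?_getD, ih]
    rw [← map_mul, ← pow_add, ← two_mul, ← pow_succ']

/-- All formal degrees are `0`. [cite: Burgisser2006, §2.2] -/
theorem gateFormalDegrees_powGates (m : ℕ) :
    gateFormalDegrees (powGates m) = List.replicate (m + 2) 0 := by
  induction m with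
  | zero => simp [powGates, gateFormalDegrees, Gate.formalDegree, Operand.formalDegree]
  | succ m ih =>
    rw [powGates, gateFormalDegrees_append_singleton, ih]
    have h0 : Gate.formalDegree (List.replicate (m + 2) 0)
        (Gate.prod [.gate (m + 1), .gate (m + 1)] : Gate ℤ (Fin 1)) = 0 := by
      simp [Gate.formalDegree, Operand.formalDegree, List.getD_eq_getElem?_getD]
    rw [h0, ← List.replicate_succ']

/-- `circuit m` computes `X₀ + 2^{2^m}`. [cite: Burgisser2006, §2.2] -/
theorem eval_circuit (m : ℕ) : (circuit m).eval = family m := by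
  have hl : (gateValues (powGates m)).length = m + 2 := by simp
  have hv := eval_gate_powGates m
  simp only [Operand.eval, List.getD_eq_getElem?_getD] at hv
  rw [circuit, ArithCircuit.eval, gateValues_append_singleton]
  simp only [Operand.eval, List.getD_eq_getElem?_getD]
  rw [List.getElem?_append_right (by omega), hl, show m + 2 - (m + 2) = 0 by omega,
    List.getElem?_cons_zero, Option.getD_some]
  simp only [Gate.eval, List.map_cons, List.map_nil, List.sum_cons, List.sum_nil, add_zero,
    one_smul, Operand.eval, List.getD_eq_getElem?_getD, hv, family]

/-- `circuit m` has formal degree `1`. [cite: Burgisser2006, §2.2] -/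
theorem formalDegree_circuit (m : ℕ) : (circuit m).formalDegree = 1 := by
  rw [circuit, ArithCircuit.formalDegree, gateFormalDegrees_append_singleton,
    gateFormalDegrees_powGates]
  simp [Operand.formalDegree, Gate.formalDegree, List.getD_eq_getElem?_getD, List.getElem?_replicate]

/-- `circuit m` has `m + 3` gates. [cite: Burgisser2000, Def. 2.1] -/
theorem size_circuit (m : ℕ) : (circuit m).size = m + 3 := by
  simp [circuit, ArithCircuit.size]

/-- `circuit m` has fan-in at most two. [cite: Burgisser2000, Def. 2.1] -/
theorem isFanInTwo_circuit (m : ℕ) : (circuit m).IsFanInTwo := by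
  intro g hg
  simp only [circuit, List.mem_append, List.mem_singleton] at hg
  rcases hg with hg | rfl
  · exact fanIn_powGates m g hg
  · simp [Gate.fanIn, Gate.args]

/-- `circuit m` has sign constants. [cite: Burgisser2000, §1.4] -/
theorem hasSignConstants_circuit (m : ℕ) : (circuit m).HasSignConstants := by
  refine ⟨fun g hg => ?_, trivial⟩
  simp only [circuit, List.mem_append, List.mem_singleton] at hg
  rcases hg with hg | rfl
  · exact hasSignConstants_powGates m g hg
  · simp [Gate.HasSignConstants, Operand.HasSignConstants, IsSignConstant]

/-- **`(X₀ + 2^{2^n})_n` is a `VP⁰` family in the tree's sense** (`IsVP0Family`: fan-in AT MOST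
two): one variable, size `n + 3`, formal degree `1`. [cite: Burgisser2006, Def. 2.7] -/
theorem isVP0Family_family : IsVP0Family (σ := fun _ => Fin 1) family := by
  refine ⟨⟨1, fun n => by simp⟩, fun n => circuit n,
    fun n => ⟨isFanInTwo_circuit n, hasSignConstants_circuit n, eval_circuit n⟩,
    ⟨3, fun n => ?_⟩, ⟨1, fun n => ?_⟩⟩
  · show (circuit n).size ≤ n ^ 3 + 3
    have := Nat.le_self_pow three_ne_zero n
    rw [size_circuit]; omega
  · show (circuit n).formalDegree ≤ n ^ 1 + 1
    rw [formalDegree_circuit]; omega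

/-- The height of `f_n`: `2^{2^n} ≤ Σ |coeff f_n|` (`coeffAbsSum`, the quantity of BIJL Lemma 25).
[cite: BlaserIkenmeyerJindalLysikov2018, Lemma 25] -/
theorem two_pow_le_coeffAbsSum_family (n : ℕ) : (2 : ℤ) ^ 2 ^ n ≤ coeffAbsSum (family n) := by
  classical
  have hc : coeff 0 (family n) = 2 ^ 2 ^ n := by
    rw [family, coeff_add, coeff_zero_X, coeff_zero_C, zero_add]
  have hmem : (0 : Fin 1 →₀ ℕ) ∈ (family n).support := by
    rw [mem_support_iff, hc]; positivity
  calc (2 : ℤ) ^ 2 ^ n = |coeff 0 (family n)| := by rw [hc, abs_of_nonneg (by positivity)]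
    _ ≤ coeffAbsSum (family n) :=
      Finset.single_le_sum (f := fun m => |coeff m (family n)|) (fun _ _ => abs_nonneg _) hmem

/-- A p-bounded function drops below `2^n` somewhere (indeed at `n = 2^{c+2}` if `t ≤ n^c + c`).
[cite: Burgisser2000, Def. 2.1(1)] -/
theorem _root_.Literature.Computability.AlgebraicComplexity.IsPBounded.exists_lt_two_pow_self
    {t : ℕ → ℕ} (ht : IsPBounded t) : ∃ n, t n < 2 ^ n := by
  obtain ⟨c, hc⟩ := ht
  refine ⟨2 ^ (c + 2), (hc _).trans_lt ?_⟩
  -- `(2^(c+2))^c + c = 2^((c+2)c) + c < 2^((c+2)c + 1) ≤ 2^(2^(c+2))`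
  have h1 : c < 2 ^ ((c + 2) * c) :=
    (Nat.lt_two_pow_self).trans_le (Nat.pow_le_pow_right (by norm_num) (Nat.le_mul_of_pos_left c (by omega)))
  have h2 : (c + 2) * c + 1 ≤ 2 ^ (c + 2) := by
    have key : ∀ d : ℕ, (d + 2) * d + 1 ≤ 2 ^ (d + 2) := by
      intro d
      induction d with
      | zero => norm_num
      | succ d ih =>
        have hd : d < 2 ^ d := Nat.lt_two_pow_self
        have : 2 ^ (d + 1 + 2) = 2 * 2 ^ (d + 2) := by ring
        rw [this]
        have h4 : 2 ^ (d + 2) = 4 * 2 ^ d := by ring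
        nlinarith
    exact key c
  calc (2 ^ (c + 2)) ^ c + c = 2 ^ ((c + 2) * c) + c := by rw [← pow_mul]
    _ < 2 ^ ((c + 2) * c) + 2 ^ ((c + 2) * c) := by omega
    _ = 2 ^ ((c + 2) * c + 1) := by ring
    _ ≤ 2 ^ 2 ^ (c + 2) := Nat.pow_le_pow_right (by norm_num) h2

/-- **No fan-in-EXACTLY-two `VP⁰` circuits for `(X₀ + 2^{2^n})_n`.** In Bürgisser's model (every
gate has exactly two operands, sign constants, size `s_n` and formal degree `d_n` p-bounded) the
height bound `Σ |coeff| ≤ 2^{s_n d_n}` (BIJL Lemma 25 = [FPdV13], the tree's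
`BIJL2018_lemma25_holds`) caps the constants, and `2^{2^n} > 2^{s_n d_n}` for large `n`.
[cite: BlaserIkenmeyerJindalLysikov2018, Lemma 25] [cite: Burgisser2006, Def. 2.7] -/
theorem not_exists_exactFanInTwo_family :
    ¬ ∃ P : ∀ n : ℕ, ArithCircuit ℤ (Fin 1),
      (∀ n, (∀ g ∈ (P n).gates, g.fanIn = 2) ∧ (P n).HasSignConstants ∧ (P n).Computes (family n)) ∧
        IsPBounded (fun n => (P n).size) ∧ IsPBounded fun n => (P n).formalDegree := by
  rintro ⟨P, hP, hsize, hdeg⟩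
  obtain ⟨n, hn⟩ := (IsPBounded.mul_holds hsize hdeg).exists_lt_two_pow_self
  obtain ⟨hfan, hsc, hcomp⟩ := hP n
  have h25 := BIJL2018_lemma25_holds (Fin 1) (P n) hfan hsc
  rw [hcomp] at h25
  have h := (two_pow_le_coeffAbsSum_family n).trans h25
  have h' : 2 ^ n ≤ (P n).size * (P n).formalDegree :=
    (pow_le_pow_iff_right₀ (by norm_num : (1 : ℤ) < 2)).1 h
  exact absurd hn (not_lt.2 h')

end VP0EmptyGates

/-- **The tree's `VP⁰` is strictly larger than fan-in-exactly-two `VP⁰`.** There is a family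
(`X₀ + 2^{2^n}`) that is `IsVP0Family` (fan-in AT MOST two: the empty product `Π ∅ = 1` and what
is built from it have formal degree `0`, so the constant `2^{2^n}` costs `n + 2` gates and NO
formal degree) but is computed by no family of fan-in-EXACTLY-two sign-constant circuits of
p-bounded size and formal degree (Bürgisser 2009, Def. 2.7, where inputs and constants have formal
degree `1` and BIJL Lemma 25 bounds the height by `2^{size · formal degree}`). Consequently a typed
statement with `IsVP0Family` in a hypothesis is stronger than its printed counterpart, and the
height bound of Lemma 25 is not available for `IsVP0Family` circuits.
[cite: Burgisser2006, Def. 2.7 and §2.2] [cite: BlaserIkenmeyerJindalLysikov2018, Lemma 25] -/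
theorem exists_isVP0Family_not_exactFanInTwo :
    ∃ f : ∀ n : ℕ, MvPolynomial (Fin 1) ℤ, IsVP0Family (σ := fun _ => Fin 1) f ∧
      ¬ ∃ P : ∀ n : ℕ, ArithCircuit ℤ (Fin 1),
        (∀ n, (∀ g ∈ (P n).gates, g.fanIn = 2) ∧ (P n).HasSignConstants ∧ (P n).Computes (f n)) ∧
          IsPBounded (fun n => (P n).size) ∧ IsPBounded fun n => (P n).formalDegree :=
  ⟨VP0EmptyGates.family, VP0EmptyGates.isVP0Family_family,
    VP0EmptyGates.not_exists_exactFanInTwo_family⟩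

end Literature.Computability.AlgebraicComplexity
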